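import Summits.CriticalPhenomena.PercolationContinuityZ3.Theorems.PercNearOneGluingNoHeavyLowerTailOneSumApexBlockGlue
import HarnessLib

/-!
# `NoHeavyLowerTail` (stmt-CriticalPhenomena-4575) — 1-sums, TERMINAL-FREE BLOCKS: a block hanging at a cut vertex `u` and containing
# none of `a, b, c` (except possibly `u` itself) does not change the three-point cells

Support file (prover prim-gen-kcluster gen 72; `--supports stmt-CriticalPhenomena-4575`).  Pure graph combinatorics: no measures, no
definitions, no named facts, no sorries.

SETTING (gen 57 §3.2 "cut vertices", the terminal-free case).  Supports `DX DY : Finset (Sym2 V)` meeting only in `u` (`hsepD`); the block `DX`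
is TERMINAL-FREE: `a, b, c` lie on no pair of `DX` unless equal to `u` (`u` itself may be the apex or a terminal).  Blocks `ζ_X = ω ∩ DX`,
`ζ_Y = ω ∖ DX`.
* `OneSumFree.mem_cl_union_iff_right` — for `Y`-side vertices `r, x` (on `DX`-pairs only if `= u`): `x ∈ C(r)` in `ζ_X ∪ ζ_Y` iff in `ζ_Y`
  (`APL.series_ou_iff`): excursions into the block return through `u`.
* `OneSumFree.glued_mem_iff` — event form for the blocks of `ω`.
* `OneSumFree.sep_iff` — `C(a)` cuts `b|c` in `DX ∪ DY` iff `C_Y(a)` cuts `b|c` in `DY`.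
Consequently every R1 cell of `(a; b, c)` for the glued graph is the corresponding cell of the `Y`-block (part 2: the masses factor and R1
transfers from `Y` to the glued graph).
-/

namespace Summit.CriticalPhenomena.PercolationContinuityZ3.Theorems

namespace OneSumFree

open SimpleGraph Finset Literature.Probability.Percolation Literature.Probability.Percolation.Gladkov
open Literature.Probability.LatticeModels RefinedRowR3 ThreePointLB APL
open scoped Classical

variable {V : Type*} [Fintype V] {DX DY : Finset (Sym2 V)} {a b c u : V}

/-- **Clusters of `Y`-side vertices ignore a block hanging at `u`** (Finset form): if the pairs of `ζ_X` and `ζ_Y` meet only in `u` and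
`r, x` lie on pairs of `ζ_X` only if equal to `u`, then `x ∈ cl (ζ_X ∪ ζ_Y) r ↔ x ∈ cl ζ_Y r`. [this work] -/
theorem mem_cl_union_iff_right {ζX ζY : Finset (Sym2 V)} {r x : V}
    (hsep : ∀ y : V, (∃ e ∈ ζX, y ∈ e) → (∃ e ∈ ζY, y ∈ e) → y = u)
    (hr : ∀ e ∈ ζX, r ∈ e → r = u) (hx : ∀ e ∈ ζX, x ∈ e → x = u) :
    x ∈ cl (ζX ∪ ζY) r ↔ x ∈ cl ζY r := by
  by_cases hxr : x = r
  · subst hxr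
    exact ⟨fun _ => mem_cl_self _ _, fun _ => mem_cl_self _ _⟩
  have hsep' : ∀ y : V, (∃ e ∈ ζY, y ∈ e) → (∃ e ∈ ζX, y ∈ e) → (y = r ∨ y = u) :=
    fun y h1 h2 => Or.inr (hsep y h2 h1)
  rw [Finset.union_comm, APL.series_ou_iff ζY ζX r u x hsep' hx hxr]
  constructor
  · rintro (h1 | ⟨h2, h3 | h3⟩)
    · exact h1
    · exact mem_cl_trans h3 (mem_cl_comm.1 h2)
    · by_cases hru : r = u
      · have h4 : u ∈ cl ζY r := by rw [hru]; exact mem_cl_self _ _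
        exact mem_cl_trans h4 (mem_cl_comm.1 h2)
      · exact absurd (ApexTwoSum.eq_of_mem_cl_of_forall_not_mem (fun e he hre => hru (hr e he hre)) h3) (Ne.symm hru)
  · exact fun h => Or.inl h

variable (hsepD : ∀ x : V, (∃ e ∈ DX, x ∈ e) → (∃ e ∈ DY, x ∈ e) → (x = u ∨ x = u))
include hsepD

/-- **Event form**: for `Y`-side vertices `r, x`, `x ∈ C(r)` in `ω ⊆ DX ∪ DY` iff in the block `ω ∖ DX`. [this work] -/
theorem glued_mem_iff {r x : V} (hr : ∀ e ∈ DX, r ∈ e → r = u) (hx : ∀ e ∈ DX, x ∈ e → x = u)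
    {ω : BondConfig V} (hω : ω ⊆ ↑DX ∪ ↑DY) :
    x ∈ cl ω.toFinset r ↔ (ω \ ↑DX) ∈ {η : BondConfig V | x ∈ cl η.toFinset r} := by
  simp only [Set.mem_setOf_eq]
  suffices key : ∀ ζX ζY : Finset (Sym2 V), (∀ e, e ∈ ζX ↔ e ∈ ω ∩ (↑DX : Set (Sym2 V))) →
      (∀ e, e ∈ ζY ↔ e ∈ ω \ (↑DX : Set (Sym2 V))) → (x ∈ cl ω.toFinset r ↔ x ∈ cl ζY r) by
    exact key (ω ∩ (↑DX : Set (Sym2 V))).toFinset _ (fun e => by simp only [Set.mem_toFinset])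
      (fun e => by simp only [Set.mem_toFinset])
  intro ζX ζY hX hY
  obtain ⟨hωζ, hXD, -, hsep⟩ := ApexTwoSum.blocks_of_eq hsepD hω hX hY
  rw [hωζ]
  exact mem_cl_union_iff_right (fun y h1 h2 => (hsep y h1 h2).elim id id) (fun e he => hr e (hXD he))
    (fun e he => hx e (hXD he))

/-- **Separation rule for a terminal-free block** (Finset form): `C(a)` cuts `b|c` in `DX ∪ DY` iff `C_Y(a)` cuts `b|c` in `DY`. [this work] -/
theorem sep_iff_fin {ζX ζY : Finset (Sym2 V)} (hζX : ζX ⊆ DX)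
    (hsep : ∀ x : V, (∃ e ∈ ζX, x ∈ e) → (∃ e ∈ ζY, x ∈ e) → x = u)
    (ha : ∀ e ∈ DX, a ∈ e → a = u) (hb : ∀ e ∈ DX, b ∈ e → b = u) (hc : ∀ e ∈ DX, c ∈ e → c = u) :
    Sep (DX ∪ DY) (cl (ζX ∪ ζY) a) b c ↔ Sep DY (cl ζY a) b c := by
  set K := cl (ζX ∪ ζY) a with hK
  set KY := cl ζY a with hKY
  -- a support pair of `DY` touches `K` iff it touches `K_Y`
  have hDY : DY \ touch K = DY \ touch KY := by
    ext e
    simp only [Finset.mem_sdiff, mem_touch, not_exists, not_and]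
    constructor
    · rintro ⟨he, h⟩
      exact ⟨he, fun x hx hxe => h x (cl_mono Finset.subset_union_right a hx) hxe⟩
    · rintro ⟨he, h⟩
      refine ⟨he, fun x hx hxe => h x ?_ hxe⟩
      have hxX : ∀ e' ∈ ζX, x ∈ e' → x = u := fun e' he' hxe' =>
        (hsepD x ⟨e', hζX he', hxe'⟩ ⟨e, he, hxe⟩).elim id id
      exact (mem_cl_union_iff_right hsep (fun e' he' hae' => ha e' (hζX he') hae') hxX).1 hx
  unfold RefinedRowR3.Sep
  rw [Finset.union_sdiff_distrib, hDY]
  -- the two pieces off the clusters again meet only in `u`, and `b, c` are on the `Y` side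
  set EX := DX \ touch K with hEX
  set EY := DY \ touch KY with hEY
  have hsepE : ∀ x : V, (∃ e ∈ EX, x ∈ e) → (∃ e ∈ EY, x ∈ e) → x = u := by
    rintro x ⟨e, he, hxe⟩ ⟨e', he', hxe'⟩
    have h1 : e ∈ DX := by rw [hEX, Finset.mem_sdiff] at he; exact he.1
    have h2 : e' ∈ DY := by rw [hEY, Finset.mem_sdiff] at he'; exact he'.1
    exact (hsepD x ⟨e, h1, hxe⟩ ⟨e', h2, hxe'⟩).elim id id
  have hbE : ∀ e ∈ EX, b ∈ e → b = u := fun e he hbe => by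
    rw [hEX, Finset.mem_sdiff] at he; exact hb e he.1 hbe
  have hcE : ∀ e ∈ EX, c ∈ e → c = u := fun e he hce => by
    rw [hEX, Finset.mem_sdiff] at he; exact hc e he.1 hce
  rw [mem_cl_union_iff_right hsepE hbE hcE]

/-- **Separation rule for a terminal-free block** (event form). [this work] -/
theorem sep_iff (ha : ∀ e ∈ DX, a ∈ e → a = u) (hb : ∀ e ∈ DX, b ∈ e → b = u) (hc : ∀ e ∈ DX, c ∈ e → c = u)
    {ω : BondConfig V} (hω : ω ⊆ ↑DX ∪ ↑DY) :
    Sep (DX ∪ DY) (cl ω.toFinset a) b c ↔ (ω \ ↑DX) ∈ {η : BondConfig V | Sep DY (cl η.toFinset a) b c} := by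
  simp only [Set.mem_setOf_eq]
  suffices key : ∀ ζX ζY : Finset (Sym2 V), (∀ e, e ∈ ζX ↔ e ∈ ω ∩ (↑DX : Set (Sym2 V))) →
      (∀ e, e ∈ ζY ↔ e ∈ ω \ (↑DX : Set (Sym2 V))) → (Sep (DX ∪ DY) (cl ω.toFinset a) b c ↔ Sep DY (cl ζY a) b c) by
    exact key (ω ∩ (↑DX : Set (Sym2 V))).toFinset _ (fun e => by simp only [Set.mem_toFinset])
      (fun e => by simp only [Set.mem_toFinset])
  intro ζX ζY hX hY
  obtain ⟨hωζ, hXD, -, hsep⟩ := ApexTwoSum.blocks_of_eq hsepD hω hX hY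
  rw [hωζ]
  exact sep_iff_fin hsepD hXD (fun y h1 h2 => (hsep y h1 h2).elim id id) ha hb hc

end OneSumFree

end Summit.CriticalPhenomena.PercolationContinuityZ3.Theorems
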